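/-
Copyright: b2b-lace packet (LEAN TYPING SEAT 1 gen 34, node KU-SEP-SINKEPT).
sin²-KEPT weighted slices of the twisted SRW moments of [NoBLE17-I] (3.34)–(3.38): the `M̂²`-expansion and
the Schwinger product-row representation of its `D̂^l D̂^{sin}` / `D̂^l (D̂^{sin})²` pieces at the SHARP
integrability range `d ≥ 2n+1` (each kept `D̂^{sin}` absorbs one power of `Ĉ`).  Elementary;
hypothesis-free; no `sorry`; nothing at a specific dimension.
-/
import Literature.Probability.FitznerVanDerHofstad2017.SrwTwistCosPowRow
import Literature.Probability.FitznerVanDerHofstad2017.SrwIntegralM2Bounds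
import Literature.Probability.FitznerVanDerHofstad2017.SrwAxisTransformBesselForm
import HarnessLib

/-!
# sin²-kept weighted slices at the sharp integrability range

CITATION HEADER (PLACEMENT v2). Part of the certified REPRODUCTION of the numerical inputs of
R. Fitzner, R. van der Hofstad, *Generalized approach to the non-backtracking lace expansion*,
Probab. Theory Related Fields 169 (2017) 1041–1119 [NoBLE17-I] (arXiv:1506.07969), §3.3.3 (3.26)
(`M̂ = D̂ − 2 D̂^{sin} Ĉ`), (3.34)–(3.38) p. 1070–1071 and §5.1–§5.2 ((5.2)–(5.5), (5.9), (5.10), (5.14)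
p. 1090–1092), as consumed by *Mean-field behavior for nearest-neighbor percolation in `d > 10`*,
Electron. J. Probab. 22 (2017) no. 43.  Origin: build `lace`, unit `b2b-lace-lean1-g34`, node KU-SEP-SINKEPT
(what-if / input-certification support; d-generic, number-free; nothing here is a certificate and nothing is
evaluated at a specific `d`).

## What is proved, and why

`SrwTwistCosPowRow.lean` prices the `M̂²`-weighted twisted moments `Tw^{w M̂²}_n(x;β)` (the `KM₂` rows of the
by-value tables) by EXPANDING `M̂² = (D̂ − 2 D̂^{sin} Ĉ)²`:
`Tw^{w M̂²}_n = Tw^{w D̂²}_n − 4 Tw^{w D̂ D̂^{sin}}_{n+1} + 4 Tw^{w (D̂^{sin})²}_{n+2}`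
(`srwTwist_weight_mul_Mhat_sq_eq`, hypothesis `d ≥ 2(n+2)+1`), and then writes the two shifted pieces at an
axis node as finite averages of Schwinger `u`-integrals of PRODUCTS of one-coordinate rows with a kept `sin²`
(`srwTwist_succ_Dhat_pow_mul_Dsin_single_eq`, `srwTwist_succ_Dhat_pow_mul_Dsin_sq_single_eq`, hypothesis
`d ≥ 2(n'+1)+1` at the shifted index `n'`).  Those hypotheses are the BOUNDED-WEIGHT integrability range of
`Ĉ^{n'}` ([HvdH17] Prop. 5.5); they lose the fact that every kept `D̂^{sin}` vanishes to second order at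
`k = 0` and therefore absorbs one power of `Ĉ`:

* `sin²(k_j) ≤ 2d (1 − D̂(k))`, hence `sin²(k_j) Ĉ(k) ≤ 2d` and `D̂^{sin} Ĉ ≤ 2/d` ((5.10))
  (`sin_sq_le_mul_one_sub_Dhat`, `sin_sq_mul_Chat_le`);
* so `w sin²(k_j) cos(β D̂^{(x)}) Ĉ^{n+1}`, `w sin²(k_j) sin²(k_{j'}) cos(β D̂^{(x)}) Ĉ^{n+2}`,
  `w D̂^{sin} cos(β D̂^{(x)}) Ĉ^{n+1}` and `w (D̂^{sin})² cos(β D̂^{(x)}) Ĉ^{n+2}` are integrable for every bounded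
  measurable `w` as soon as `d ≥ 2n+1` (`integrable_weight_sin_sq_cos_mul_Chat_pow_succ`, …);
* consequently the `M̂²`-expansion holds for `d ≥ 2n+1` (`srwTwist_weight_mul_Mhat_sq_eq_sharp`,
  `srwTwist_Dhat_pow_mul_Mhat_sq_eq_sharp`, `srwTwist_abs_Dhat_pow_mul_Mhat_sq_eq_sharp_of_even`) — the
  pointwise identity is a ring identity, only the termwise integrability was at stake;
* the Schwinger parametrisation `∫ W Ĉ^{n+1} = (n!)⁻¹ ∫₀^∞ τⁿ ∫ W e^{-(1-D̂)τ}` needs only `W Ĉ^{n+1} ∈ L¹`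
  (the tree's `integral_mul_Chat_pow_succ_eq_integral_Ioi`), so the product-weight form of
  `SrwTwistProductWeight.lean` holds under that hypothesis
  (`srwTwist_succ_prod_single_eq_integral_of_integrable`, same conclusion as
  `srwTwist_succ_prod_single_eq_integral`);
* hence the sin²-kept product-row representations hold with `d ≥ 2n+1` for `Tw_{n+1}[D̂^l D̂^{sin}]` and for
  `Tw_{n+2}[D̂^l (D̂^{sin})²]` (`srwTwist_succ_Dhat_pow_mul_Dsin_single_eq_sharp`,
  `srwTwist_succ_succ_Dhat_pow_mul_Dsin_sq_single_eq_sharp`, and the `|D̂|^l`, `l` even, forms) — the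
  conclusions are VERBATIM those of the bounded-range theorems (at index `n`, resp. `n+1`), so a row kernel
  consumes them unchanged; the one-coordinate rows are the `cos^a sin²` / `cos^a sin² sin²` rows of
  `integral_cos_pow_mul_sin_sq_row_eq_sub` / `integral_cos_pow_mul_sin_sq_mul_sin_sq_row_eq`.

Net effect, stated d-generically: the `M̂²`-weighted twisted moments at `Ĉ`-index `n` are priced by product
rows whenever `d ≥ 2n+1`, the same range in which `KM₂_{n,l}(x)` itself is defined by a convergent integral
(`integrable_srwKM2_integrand`).  Linearity of `Tw` in the weight is used in the integrability-hypothesis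
form `srwTwist_sum_weight_of_integrable`.

## References
* [NoBLE17-I] R. Fitzner, R. van der Hofstad, PTRF 169 (2017) 1041–1119; arXiv:1506.07969 — (3.26),
  (3.34)–(3.38) p. 1070–1071; §5.1.1 (5.2)–(5.5); §5.2 (5.9), (5.10), (5.14) p. 1091–1092.
* [HvdH17] M. Heydenreich, R. van der Hofstad, *Progress in high-dimensional percolation and random graphs*,
  Springer 2017 — Prop. 5.5 (integrability of `Ĉⁿ` on the torus for `d > 2n`).
* [DLMF] NIST Digital Library of Mathematical Functions, 10.32.1 (the modified Bessel rows).
-/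

noncomputable section

open MeasureTheory Set Filter Real
open scoped Topology Nat

namespace Literature.Probability.FitznerVanDerHofstad2017

open Literature.Barriers.CriticalPhenomena
open Literature.Barriers.CriticalPhenomena.Slade2006Prop53 (μI P)
open Literature.Probability.LatticeModels (besselI)

variable {d : ℕ}

/-! ### A kept `sin²` absorbs one power of `Ĉ` -/

/-- `sin²(k_j) ≤ 2d (1 − D̂(k))`: `sin² = (1 − cos)(1 + cos) ≤ 2 (1 − cos k_j)` and
`1 − cos k_j ≤ Σ_μ (1 − cos k_μ) = d (1 − D̂(k))`. [cite: FitznerVanDerHofstad2016NoBLE, §5.2 (5.10) p. 1092] -/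
theorem sin_sq_le_mul_one_sub_Dhat (j : Fin d) (k : Fin d → ℝ) :
    Real.sin (k j) ^ 2 ≤ 2 * d * (1 - Dhat d k) := by
  haveI : NeZero d := ⟨(Fin.pos j).ne'⟩
  have hd0 : (0 : ℝ) < d := by exact_mod_cast Fin.pos j
  have h1 : (d : ℝ) * (1 - Dhat d k) = ∑ μ, (1 - Real.cos (k μ)) := by
    rw [one_sub_Dhat k]
    field_simp
  have h2 : 1 - Real.cos (k j) ≤ ∑ μ, (1 - Real.cos (k μ)) :=
    Finset.single_le_sum (f := fun μ => 1 - Real.cos (k μ))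
      (fun μ _ => sub_nonneg.2 (Real.cos_le_one _)) (Finset.mem_univ j)
  have h3 : Real.sin (k j) ^ 2 = (1 - Real.cos (k j)) * (1 + Real.cos (k j)) := by
    rw [Real.sin_sq]; ring
  rw [h3]
  calc (1 - Real.cos (k j)) * (1 + Real.cos (k j)) ≤ (1 - Real.cos (k j)) * 2 :=
        mul_le_mul_of_nonneg_left (by linarith [Real.cos_le_one (k j)])
          (sub_nonneg.2 (Real.cos_le_one _))
    _ ≤ (∑ μ, (1 - Real.cos (k μ))) * 2 := by gcongr
    _ = 2 * d * (1 - Dhat d k) := by rw [← h1]; ring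

/-- `0 ≤ sin²(k_j) Ĉ(k)`. [cite: FitznerVanDerHofstad2016NoBLE, §5.2 (5.10) p. 1092] -/
theorem sin_sq_mul_Chat_nonneg (j : Fin d) (k : Fin d → ℝ) : 0 ≤ Real.sin (k j) ^ 2 * Chat d 1 k :=
  mul_nonneg (sq_nonneg _) (Chat_one_nonneg k)

/-- `sin²(k_j) Ĉ(k) ≤ 2d` — the per-coordinate form of `D̂^{sin} Ĉ ≤ 2/d` ((5.10)); at the null point
`D̂ = 1` the left side is the junk value `0`. [cite: FitznerVanDerHofstad2016NoBLE, §5.2 (5.10) p. 1092] -/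
theorem sin_sq_mul_Chat_le (j : Fin d) (k : Fin d → ℝ) : Real.sin (k j) ^ 2 * Chat d 1 k ≤ 2 * d := by
  have h := sin_sq_le_mul_one_sub_Dhat j k
  by_cases h0 : 1 - Dhat d k = 0
  · have : Chat d 1 k = 0 := by rw [Chat, one_mul, h0, div_zero]
    rw [this, mul_zero]; positivity
  · have hpos : 0 < 1 - Dhat d k := lt_of_le_of_ne (one_sub_Dhat_nonneg k) (Ne.symm h0)
    have hC : Chat d 1 k = 1 / (1 - Dhat d k) := by rw [Chat, one_mul]
    rw [hC, mul_one_div, div_le_iff₀ hpos]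
    exact h

/-! ### Integrability one `Ĉ`-power beyond the bounded-weight range -/

/-- **A kept `sin²(k_j)` absorbs one `Ĉ`**: for a bounded measurable weight `w` and `d ≥ 2n+1`,
`(w sin²(k_j)) cos(β D̂^{(x)}) Ĉ^{n+1} ∈ L¹` (it is the bounded weight `w · sin²(k_j)Ĉ · cos` against `Ĉⁿ`).
[cite: FitznerVanDerHofstad2016NoBLE, §5.2 (5.10) p. 1092; HeydenreichVanDerHofstad2017, Prop. 5.5] -/
theorem integrable_weight_sin_sq_cos_mul_Chat_pow_succ {n : ℕ} (hd : 2 * n + 1 ≤ d)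
    {w : (Fin d → ℝ) → ℝ} (hw : Measurable w) {W : ℝ} (hw1 : ∀ k, |w k| ≤ W) (j : Fin d)
    (x : Fin d → ℤ) (β : ℝ) :
    Integrable (fun k => ((w k * Real.sin (k j) ^ 2) * Real.cos (β * DhatSym d x k))
      * Chat d 1 k ^ (n + 1)) (P d) := by
  have hm : Measurable fun k : Fin d → ℝ => w k * (Real.sin (k j) ^ 2 * Chat d 1 k) :=
    hw.mul (((Real.measurable_sin.comp (measurable_pi_apply j)).pow_const 2).mul (measurable_Chat_one d))
  have hb : ∀ k, |w k * (Real.sin (k j) ^ 2 * Chat d 1 k)| ≤ W * (2 * d) := fun k => by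
    rw [abs_mul, abs_of_nonneg (sin_sq_mul_Chat_nonneg j k)]
    exact mul_le_mul (hw1 k) (sin_sq_mul_Chat_le j k) (sin_sq_mul_Chat_nonneg j k)
      ((abs_nonneg _).trans (hw1 k))
  refine (integrable_weight_cos_mul_Chat_pow hd hm hb x β).congr (ae_of_all _ fun k => ?_)
  simp only [pow_succ]
  ring

/-- Two kept `sin²` factors absorb two powers of `Ĉ` (`d ≥ 2n+1`, `Ĉ`-power `n+2`).
[cite: FitznerVanDerHofstad2016NoBLE, §5.2 (5.10), (5.14) p. 1092; HeydenreichVanDerHofstad2017, Prop. 5.5] -/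
theorem integrable_weight_sin_sq_sin_sq_cos_mul_Chat_pow_succ_succ {n : ℕ} (hd : 2 * n + 1 ≤ d)
    {w : (Fin d → ℝ) → ℝ} (hw : Measurable w) {W : ℝ} (hw1 : ∀ k, |w k| ≤ W) (j j' : Fin d)
    (x : Fin d → ℤ) (β : ℝ) :
    Integrable (fun k => ((w k * Real.sin (k j) ^ 2 * Real.sin (k j') ^ 2) * Real.cos (β * DhatSym d x k))
      * Chat d 1 k ^ (n + 2)) (P d) := by
  have hm : Measurable fun k : Fin d → ℝ =>
      w k * (Real.sin (k j) ^ 2 * Chat d 1 k) * (Real.sin (k j') ^ 2 * Chat d 1 k) :=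
    (hw.mul (((Real.measurable_sin.comp (measurable_pi_apply j)).pow_const 2).mul
      (measurable_Chat_one d))).mul
      (((Real.measurable_sin.comp (measurable_pi_apply j')).pow_const 2).mul (measurable_Chat_one d))
  have hb : ∀ k, |w k * (Real.sin (k j) ^ 2 * Chat d 1 k) * (Real.sin (k j') ^ 2 * Chat d 1 k)|
      ≤ W * (2 * d) * (2 * d) := fun k => by
    rw [abs_mul, abs_mul, abs_of_nonneg (sin_sq_mul_Chat_nonneg j k),
      abs_of_nonneg (sin_sq_mul_Chat_nonneg j' k)]
    have hW : |w k| * (Real.sin (k j) ^ 2 * Chat d 1 k) ≤ W * (2 * d) :=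
      mul_le_mul (hw1 k) (sin_sq_mul_Chat_le j k) (sin_sq_mul_Chat_nonneg j k)
        ((abs_nonneg _).trans (hw1 k))
    exact mul_le_mul hW (sin_sq_mul_Chat_le j' k) (sin_sq_mul_Chat_nonneg j' k)
      ((mul_nonneg (abs_nonneg _) (sin_sq_mul_Chat_nonneg j k)).trans hW)
  refine (integrable_weight_cos_mul_Chat_pow hd hm hb x β).congr (ae_of_all _ fun k => ?_)
  simp only [pow_succ]
  ring

/-- **A kept `D̂^{sin}` absorbs one `Ĉ`**: `(w D̂^{sin}) cos(β D̂^{(x)}) Ĉ^{n+1} ∈ L¹` for bounded measurable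
`w` and `d ≥ 2n+1` (`D̂^{sin} Ĉ ≤ 2/d`; cf. `integrable_srwU_integrand_succ`).
[cite: FitznerVanDerHofstad2016NoBLE, §5.2 (5.10) p. 1092; HeydenreichVanDerHofstad2017, Prop. 5.5] -/
theorem integrable_weight_Dsin_cos_mul_Chat_pow_succ {n : ℕ} (hd : 2 * n + 1 ≤ d)
    {w : (Fin d → ℝ) → ℝ} (hw : Measurable w) {W : ℝ} (hw1 : ∀ k, |w k| ≤ W)
    (x : Fin d → ℤ) (β : ℝ) :
    Integrable (fun k => ((w k * Dsin d k) * Real.cos (β * DhatSym d x k))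
      * Chat d 1 k ^ (n + 1)) (P d) := by
  have hd1 : 1 ≤ d := by omega
  have hDC0 : ∀ k : Fin d → ℝ, 0 ≤ Dsin d k * Chat d 1 k := fun k =>
    mul_nonneg (Dsin_nonneg k) (Chat_one_nonneg k)
  have hm : Measurable fun k : Fin d → ℝ => w k * (Dsin d k * Chat d 1 k) :=
    hw.mul ((continuous_Dsin d).measurable.mul (measurable_Chat_one d))
  have hb : ∀ k, |w k * (Dsin d k * Chat d 1 k)| ≤ W * (2 / d) := fun k => by
    rw [abs_mul, abs_of_nonneg (hDC0 k)]
    exact mul_le_mul (hw1 k) (Dsin_mul_Chat_le hd1 k) (hDC0 k) ((abs_nonneg _).trans (hw1 k))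
  refine (integrable_weight_cos_mul_Chat_pow hd hm hb x β).congr (ae_of_all _ fun k => ?_)
  simp only [pow_succ]
  ring

/-- Two kept `D̂^{sin}` factors absorb two powers of `Ĉ`: `(w (D̂^{sin})²) cos(β D̂^{(x)}) Ĉ^{n+2} ∈ L¹` for
bounded measurable `w` and `d ≥ 2n+1`.
[cite: FitznerVanDerHofstad2016NoBLE, §5.2 (5.10), (5.14) p. 1092; HeydenreichVanDerHofstad2017, Prop. 5.5] -/
theorem integrable_weight_Dsin_sq_cos_mul_Chat_pow_succ_succ {n : ℕ} (hd : 2 * n + 1 ≤ d)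
    {w : (Fin d → ℝ) → ℝ} (hw : Measurable w) {W : ℝ} (hw1 : ∀ k, |w k| ≤ W)
    (x : Fin d → ℤ) (β : ℝ) :
    Integrable (fun k => ((w k * Dsin d k ^ 2) * Real.cos (β * DhatSym d x k))
      * Chat d 1 k ^ (n + 2)) (P d) := by
  have hd1 : 1 ≤ d := by omega
  have hDC0 : ∀ k : Fin d → ℝ, 0 ≤ Dsin d k * Chat d 1 k := fun k =>
    mul_nonneg (Dsin_nonneg k) (Chat_one_nonneg k)
  have hm : Measurable fun k : Fin d → ℝ => w k * (Dsin d k * Chat d 1 k) * (Dsin d k * Chat d 1 k) :=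
    (hw.mul ((continuous_Dsin d).measurable.mul (measurable_Chat_one d))).mul
      ((continuous_Dsin d).measurable.mul (measurable_Chat_one d))
  have hb : ∀ k, |w k * (Dsin d k * Chat d 1 k) * (Dsin d k * Chat d 1 k)| ≤ W * (2 / d) * (2 / d) :=
    fun k => by
    rw [abs_mul, abs_mul, abs_of_nonneg (hDC0 k)]
    have hW : |w k| * (Dsin d k * Chat d 1 k) ≤ W * (2 / d) :=
      mul_le_mul (hw1 k) (Dsin_mul_Chat_le hd1 k) (hDC0 k) ((abs_nonneg _).trans (hw1 k))
    exact mul_le_mul hW (Dsin_mul_Chat_le hd1 k) (hDC0 k)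
      ((mul_nonneg (abs_nonneg _) (hDC0 k)).trans hW)
  refine (integrable_weight_cos_mul_Chat_pow hd hm hb x β).congr (ae_of_all _ fun k => ?_)
  simp only [pow_succ]
  ring

/-! ### Linearity of `Tw` in the weight under integrability hypotheses -/

/-- **`srwTwist` is linear in the weight** (integrability-hypothesis form of `srwTwist_sum_weight`):
`Tw_n[Σ_i c_i w_i](x;β) = Σ_i c_i Tw_n[w_i](x;β)` whenever every `w_i cos(β D̂^{(x)}) Ĉⁿ` is integrable.
[cite: FitznerVanDerHofstad2016NoBLE, (3.34)–(3.36) p. 1071; (5.9) p. 1092] -/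
theorem srwTwist_sum_weight_of_integrable {ι : Type*} (s : Finset ι) (c : ι → ℝ)
    (w : ι → (Fin d → ℝ) → ℝ) {n : ℕ} (x : Fin d → ℤ) (β : ℝ)
    (hint : ∀ i ∈ s, Integrable (fun k => (w i k * Real.cos (β * DhatSym d x k)) * Chat d 1 k ^ n) (P d)) :
    srwTwist d n (fun k => ∑ i ∈ s, c i * w i k) x β = ∑ i ∈ s, c i * srwTwist d n (w i) x β := by
  unfold srwTwist
  have hint' : ∀ i ∈ s, Integrable (fun k => c i * ((w i k * Real.cos (β * DhatSym d x k))
      * Chat d 1 k ^ n)) (P d) := fun i hi => (hint i hi).const_mul (c i)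
  have hptw : (fun k : Fin d → ℝ => ((∑ i ∈ s, c i * w i k) * Real.cos (β * DhatSym d x k))
      * Chat d 1 k ^ n)
      = fun k => ∑ i ∈ s, c i * ((w i k * Real.cos (β * DhatSym d x k)) * Chat d 1 k ^ n) := by
    funext k
    rw [Finset.sum_mul, Finset.sum_mul]
    refine Finset.sum_congr rfl fun i _ => ?_
    ring
  rw [hptw, integral_finsetSum s hint', Finset.sum_div]
  refine Finset.sum_congr rfl fun i _ => ?_
  rw [integral_const_mul, mul_div_assoc]

/-! ### The `M̂²` insertion at the sharp range -/

/-- **The `M̂²` insertion, sharp range.** For a bounded measurable weight `w` and `d ≥ 2n + 1`: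
`Tw^{w M̂²}_n(x;β) = Tw^{w D̂²}_n(x;β) − 4 Tw^{w D̂ D̂^{sin}}_{n+1}(x;β) + 4 Tw^{w (D̂^{sin})²}_{n+2}(x;β)` — the
conclusion of `srwTwist_weight_mul_Mhat_sq_eq` with its hypothesis `d ≥ 2n+5` replaced by `d ≥ 2n+1`: the two
shifted integrands are integrable because each `D̂^{sin}` absorbs one `Ĉ`
(`integrable_weight_Dsin_cos_mul_Chat_pow_succ`, `integrable_weight_Dsin_sq_cos_mul_Chat_pow_succ_succ`), and
pointwise `w M̂² Ĉⁿ = w D̂² Ĉⁿ − 4 (w D̂ D̂^{sin}) Ĉ^{n+1} + 4 (w (D̂^{sin})²) Ĉ^{n+2}` is a ring identity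
(`M̂ = D̂ − 2 D̂^{sin} Ĉ`, (3.26)).
[cite: FitznerVanDerHofstad2016NoBLE, §3.3.3 (3.26) p. 1070, (3.34)–(3.38) p. 1071, §5.2 (5.9), (5.10), (5.14) p. 1092] -/
theorem srwTwist_weight_mul_Mhat_sq_eq_sharp {n : ℕ} (hd : 2 * n + 1 ≤ d) {w : (Fin d → ℝ) → ℝ}
    (hw : Measurable w) {W : ℝ} (hw1 : ∀ k, |w k| ≤ W) (x : Fin d → ℤ) (β : ℝ) :
    srwTwist d n (fun k => w k * Mhat d k ^ 2) x β
      = srwTwist d n (fun k => w k * Dhat d k ^ 2) x β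
        - 4 * srwTwist d (n + 1) (fun k => w k * Dhat d k * Dsin d k) x β
        + 4 * srwTwist d (n + 2) (fun k => w k * Dsin d k ^ 2) x β := by
  have hmD : Measurable (Dhat d) := (continuous_Dhat d).measurable
  have hW0 : 0 ≤ W := (abs_nonneg _).trans (hw1 fun _ => 0)
  set A : (Fin d → ℝ) → ℝ := fun k => w k * Dhat d k ^ 2 with hA
  set B : (Fin d → ℝ) → ℝ := fun k => w k * Dhat d k * Dsin d k with hB
  set C : (Fin d → ℝ) → ℝ := fun k => w k * Dsin d k ^ 2 with hC
  have hA1 : ∀ k, |A k| ≤ W := fun k => by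
    rw [hA, abs_mul, abs_pow]
    exact (mul_le_mul (hw1 k) (pow_le_one₀ (abs_nonneg _) (abs_Dhat_le_one k)) (by positivity)
      hW0).trans_eq (mul_one W)
  have hwD1 : ∀ k, |w k * Dhat d k| ≤ W := fun k => by
    rw [abs_mul]
    exact (mul_le_mul (hw1 k) (abs_Dhat_le_one k) (abs_nonneg _) hW0).trans_eq (mul_one W)
  have hAm : Measurable A := hw.mul (hmD.pow_const 2)
  have hiA := integrable_weight_cos_mul_Chat_pow (n := n) hd hAm hA1 x β
  have hiB' : Integrable (fun k => (B k * Real.cos (β * DhatSym d x k)) * Chat d 1 k ^ (n + 1)) (P d) :=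
    integrable_weight_Dsin_cos_mul_Chat_pow_succ hd (hw.mul hmD) hwD1 x β
  have hiC' : Integrable (fun k => (C k * Real.cos (β * DhatSym d x k)) * Chat d 1 k ^ (n + 2)) (P d) :=
    integrable_weight_Dsin_sq_cos_mul_Chat_pow_succ_succ hd hw hw1 x β
  have hiB : Integrable (fun k => (((-4) * B k * Chat d 1 k) * Real.cos (β * DhatSym d x k))
      * Chat d 1 k ^ n) (P d) := by
    refine (hiB'.const_mul (-4)).congr (ae_of_all _ fun k => ?_)
    simp only [pow_succ]
    ring
  have hiC : Integrable (fun k => ((4 * C k * Chat d 1 k ^ 2) * Real.cos (β * DhatSym d x k))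
      * Chat d 1 k ^ n) (P d) := by
    refine (hiC'.const_mul 4).congr (ae_of_all _ fun k => ?_)
    simp only [pow_add]
    ring
  have hiBC : Integrable (fun k => (((-4) * B k * Chat d 1 k + 4 * C k * Chat d 1 k ^ 2)
      * Real.cos (β * DhatSym d x k)) * Chat d 1 k ^ n) (P d) := by
    refine (hiB.add hiC).congr (ae_of_all _ fun k => ?_)
    simp only [Pi.add_apply]
    ring
  have hw' : (fun k => w k * Mhat d k ^ 2)
      = fun k => A k + ((-4) * B k * Chat d 1 k + 4 * C k * Chat d 1 k ^ 2) := by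
    funext k
    simp only [hA, hB, hC, Mhat]
    ring
  have eB : srwTwist d n (fun k => (-4) * B k * Chat d 1 k) x β = -4 * srwTwist d (n + 1) B x β := by
    have h : (fun k => (-4) * B k * Chat d 1 k) = fun k => (-4) * (B k * Chat d 1 k ^ 1) := by
      funext k; rw [pow_one]; ring
    rw [h, srwTwist_const_mul_weight, srwTwist_weight_mul_Chat_pow_eq]
  have eC : srwTwist d n (fun k => 4 * C k * Chat d 1 k ^ 2) x β = 4 * srwTwist d (n + 2) C x β := by
    have h : (fun k => 4 * C k * Chat d 1 k ^ 2) = fun k => 4 * (C k * Chat d 1 k ^ 2) := by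
      funext k; ring
    rw [h, srwTwist_const_mul_weight, srwTwist_weight_mul_Chat_pow_eq]
  rw [hw', srwTwist_add_weight A (fun k => (-4) * B k * Chat d 1 k + 4 * C k * Chat d 1 k ^ 2) x β
    hiA hiBC, srwTwist_add_weight (fun k => (-4) * B k * Chat d 1 k) (fun k => 4 * C k * Chat d 1 k ^ 2)
    x β hiB hiC, eB, eC]
  ring

/-- **`Tw^{D̂^l M̂²}_n`, sharp range** (`d ≥ 2n+1`):
`Tw^{D̂^l M̂²}_n(x;β) = Tw^{D̂^{l+2}}_n − 4 Tw^{D̂^{l+1} D̂^{sin}}_{n+1} + 4 Tw^{D̂^l (D̂^{sin})²}_{n+2}` — the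
conclusion of `srwTwist_Dhat_pow_mul_Mhat_sq_eq` under `d ≥ 2n+1`.
[cite: FitznerVanDerHofstad2016NoBLE, §3.3.3 (3.26) p. 1070, (3.34)–(3.38) p. 1071, §5.2 (5.9), (5.14) p. 1092] -/
theorem srwTwist_Dhat_pow_mul_Mhat_sq_eq_sharp {n : ℕ} (hd : 2 * n + 1 ≤ d) (x : Fin d → ℤ) (β : ℝ)
    (l : ℕ) :
    srwTwist d n (fun k => Dhat d k ^ l * Mhat d k ^ 2) x β
      = srwTwist d n (fun k => Dhat d k ^ (l + 2)) x β
        - 4 * srwTwist d (n + 1) (fun k => Dhat d k ^ (l + 1) * Dsin d k) x β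
        + 4 * srwTwist d (n + 2) (fun k => Dhat d k ^ l * Dsin d k ^ 2) x β := by
  have h := srwTwist_weight_mul_Mhat_sq_eq_sharp hd (w := fun k => Dhat d k ^ l)
    ((continuous_Dhat d).measurable.pow_const l)
    (fun k => by rw [abs_pow]; exact pow_le_one₀ (abs_nonneg _) (abs_Dhat_le_one k)) x β
  have e1 : (fun k : Fin d → ℝ => Dhat d k ^ l * Dhat d k ^ 2) = fun k => Dhat d k ^ (l + 2) := by
    funext k; rw [pow_add]
  have e2 : (fun k : Fin d → ℝ => Dhat d k ^ l * Dhat d k * Dsin d k)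
      = fun k => Dhat d k ^ (l + 1) * Dsin d k := by
    funext k; rw [pow_succ]
  rw [e1, e2] at h
  exact h

/-- For even `l`, `|D̂|^l = D̂^l`: the `|D̂|^l M̂²`-weighted twisted moment (the weight of the `KM₂` rows) at
the sharp range `d ≥ 2n+1`.
[cite: FitznerVanDerHofstad2016NoBLE, §3.3.3 (3.26) p. 1070, (3.34)–(3.38) p. 1071, §5.2 (5.9), (5.14) p. 1092] -/
theorem srwTwist_abs_Dhat_pow_mul_Mhat_sq_eq_sharp_of_even {n : ℕ} (hd : 2 * n + 1 ≤ d)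
    (x : Fin d → ℤ) (β : ℝ) {l : ℕ} (hl : Even l) :
    srwTwist d n (fun k => |Dhat d k| ^ l * Mhat d k ^ 2) x β
      = srwTwist d n (fun k => Dhat d k ^ (l + 2)) x β
        - 4 * srwTwist d (n + 1) (fun k => Dhat d k ^ (l + 1) * Dsin d k) x β
        + 4 * srwTwist d (n + 2) (fun k => Dhat d k ^ l * Dsin d k ^ 2) x β := by
  have hw : (fun k : Fin d → ℝ => |Dhat d k| ^ l * Mhat d k ^ 2) = fun k => Dhat d k ^ l * Mhat d k ^ 2 := by
    funext k; rw [hl.pow_abs]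
  rw [hw]
  exact srwTwist_Dhat_pow_mul_Mhat_sq_eq_sharp hd x β l

/-! ### The Schwinger product form under the natural integrability hypothesis -/

/-- **Product-weighted twisted seed at an axis node, integrability-hypothesis form.** For an axis `i`,
`m : ℤ`, continuous one-coordinate weights with `|g_μ| ≤ 1`, and `(Π_μ g_μ(k_μ)) cos(β D̂^{(m e_i)}) Ĉ^{n+1} ∈ L¹`:
`Tw_{n+1}[∏_μ g_μ(k_μ)](m e_i; β) = (n!)⁻¹ (∫₀^∞ τⁿ e^{-τ} Re ∏_μ T^{g_μ}_m(τ/d, β/d) dτ)/(2π)^d`,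
`T^{g}_m(v,y) = ∫_{[-π,π]} g(t) e^{v cos t + iy cos(mt)} dt` — the conclusion of
`srwTwist_succ_prod_single_eq_integral`, whose hypothesis `d ≥ 2n+3` only served to supply the integrability
(the Schwinger step is the tree's `integral_mul_Chat_pow_succ_eq_integral_Ioi`, which needs exactly
`W Ĉ^{n+1} ∈ L¹`).
[cite: FitznerVanDerHofstad2016NoBLE, (3.34)–(3.36) p. 1071; FitznerVanDerHofstad2016NoBLE, §5.1.1 (5.2)–(5.4)] -/
theorem srwTwist_succ_prod_single_eq_integral_of_integrable (n : ℕ) (i : Fin d) (m : ℤ)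
    (β : ℝ) (g : Fin d → ℝ → ℝ) (hg : ∀ μ, Continuous (g μ)) (hg1 : ∀ μ t, |g μ t| ≤ 1)
    (hint : Integrable (fun k => ((∏ μ, g μ (k μ)) * Real.cos (β * DhatSym d (Pi.single i m) k))
      * Chat d 1 k ^ (n + 1)) (P d)) :
    srwTwist d (n + 1) (fun k => ∏ μ, g μ (k μ)) (Pi.single i m) β
      = (n ! : ℝ)⁻¹ * (∫ τ in Ioi (0:ℝ), τ ^ n * (Real.exp (-τ) *
          (∏ μ, ∫ t, (g μ t : ℂ) * Complex.exp (((τ / d * Real.cos t : ℝ) : ℂ)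
              + ((β / d * Real.cos (m * t) : ℝ) : ℂ) * Complex.I) ∂μI).re)) / (2 * π) ^ d := by
  have hd0 : (d : ℝ) ≠ 0 := by
    have : 0 < d := Fin.pos i
    positivity
  have hph : ∀ k : Fin d → ℝ, β * DhatSym d (Pi.single i m) k = β / d * ∑ j, Real.cos (m * k j) := by
    intro k
    rw [← natCast_mul_DhatSym_single_intCast i m k]
    field_simp
  have hgc : ∀ μ, Continuous (fun k : Fin d → ℝ => g μ (k μ)) := fun μ =>
    (hg μ).comp (continuous_apply μ)
  have hp : Continuous (fun k : Fin d → ℝ => ∏ μ, g μ (k μ)) :=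
    continuous_finsetProd _ (fun μ _ => hgc μ)
  have hWm : Measurable fun k : Fin d → ℝ =>
      (∏ μ, g μ (k μ)) * Real.cos (β * DhatSym d (Pi.single i m) k) := by
    have := continuous_DhatSym d (Pi.single i m)
    exact Continuous.measurable (by fun_prop)
  unfold srwTwist
  rw [integral_mul_Chat_pow_succ_eq_integral_Ioi n hWm.aestronglyMeasurable hint]
  congr 1
  congr 1
  refine setIntegral_congr_fun measurableSet_Ioi fun τ _ => ?_
  congr 1
  have hexp : ∀ k : Fin d → ℝ, Real.exp (-((1 - Dhat d k) * τ))
      = Real.exp (-τ) * Real.exp (τ * Dhat d k) := by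
    intro k; rw [← Real.exp_add]; congr 1; ring
  simp_rw [hph, hexp]
  calc ∫ k, (∏ μ, g μ (k μ)) * Real.cos (β / d * ∑ j, Real.cos (m * k j))
        * (Real.exp (-τ) * Real.exp (τ * Dhat d k)) ∂P d
      = Real.exp (-τ) * ∫ k, (∏ μ, g μ (k μ))
          * (Real.exp (τ * Dhat d k) * Real.cos (β / d * ∑ j, Real.cos (m * k j))) ∂P d := by
        rw [← integral_const_mul]
        congr 1
        funext k
        ring
    _ = Real.exp (-τ) * (∏ μ, ∫ t, (g μ t : ℂ) * Complex.exp (((τ / d * Real.cos t : ℝ) : ℂ)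
          + ((β / d * Real.cos (m * t) : ℝ) : ℂ) * Complex.I) ∂μI).re := by
        rw [integral_prod_mul_exp_Dhat_mul_cos_P g hg hg1 τ (β / d) m]

/-! ### sin²-kept product rows for `D̂^l D̂^{sin}` and `D̂^l (D̂^{sin})²` at the sharp range -/

/-- A product cos-power weight with a kept `sin²` at coordinate `j`, as `(Π cos^{a}) · sin²(k_j)`. [folklore] -/
private theorem prod_cosPow_ite_sin_sq_eq (a : Fin d → ℕ) (j : Fin d) (k : Fin d → ℝ) :
    ∏ μ, (Real.cos (k μ) ^ a μ * (if μ = j then Real.sin (k μ) ^ 2 else 1))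
      = (∏ μ, Real.cos (k μ) ^ a μ) * Real.sin (k j) ^ 2 := by
  rw [Finset.prod_mul_distrib, Finset.prod_ite_eq']
  simp

/-- The same with two kept `sin²`, at `j` and `j'`. [folklore] -/
private theorem prod_cosPow_ite_sin_sq_ite_sin_sq_eq (a : Fin d → ℕ) (j j' : Fin d) (k : Fin d → ℝ) :
    ∏ μ, (Real.cos (k μ) ^ a μ * (if μ = j then Real.sin (k μ) ^ 2 else 1)
        * (if μ = j' then Real.sin (k μ) ^ 2 else 1))
      = (∏ μ, Real.cos (k μ) ^ a μ) * Real.sin (k j) ^ 2 * Real.sin (k j') ^ 2 := by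
  rw [Finset.prod_mul_distrib, Finset.prod_mul_distrib, Finset.prod_ite_eq', Finset.prod_ite_eq']
  simp

/-- `Π_μ cos^{a_μ}(k_μ)` is measurable and bounded by `1`. [folklore] -/
private theorem measurable_prod_cosPow (a : Fin d → ℕ) :
    Measurable fun k : Fin d → ℝ => ∏ μ, Real.cos (k μ) ^ a μ := by
  fun_prop

/-- `|Π_μ cos^{a_μ}(k_μ)| ≤ 1`. [folklore] -/
private theorem abs_prod_cosPow_le_one (a : Fin d → ℕ) (k : Fin d → ℝ) :
    |∏ μ, Real.cos (k μ) ^ a μ| ≤ 1 := by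
  rw [Finset.abs_prod]
  exact Finset.prod_le_one (fun _ _ => abs_nonneg _)
    (fun μ _ => by rw [abs_pow]; exact pow_le_one₀ (abs_nonneg _) (abs_cos_le_one _))

/-- One kept `sin²`: `(Π_μ cos^{a_μ} [μ=j] sin²) cos(β D̂^{(x)}) Ĉ^{n+1} ∈ L¹` for `d ≥ 2n+1`.
[cite: FitznerVanDerHofstad2016NoBLE, §5.2 (5.10) p. 1092; HeydenreichVanDerHofstad2017, Prop. 5.5] -/
theorem integrable_prodCosPow_sin_sq_cos_mul_Chat_pow_succ {n : ℕ} (hd : 2 * n + 1 ≤ d)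
    (a : Fin d → ℕ) (j : Fin d) (x : Fin d → ℤ) (β : ℝ) :
    Integrable (fun k => ((∏ μ, (Real.cos (k μ) ^ a μ * (if μ = j then Real.sin (k μ) ^ 2 else 1)))
      * Real.cos (β * DhatSym d x k)) * Chat d 1 k ^ (n + 1)) (P d) := by
  refine (integrable_weight_sin_sq_cos_mul_Chat_pow_succ hd (measurable_prod_cosPow a)
    (abs_prod_cosPow_le_one a) j x β).congr (ae_of_all _ fun k => ?_)
  simp only [prod_cosPow_ite_sin_sq_eq]

/-- Two kept `sin²`: `(Π_μ cos^{a_μ} [μ=j] sin² [μ=j'] sin²) cos(β D̂^{(x)}) Ĉ^{n+2} ∈ L¹` for `d ≥ 2n+1`.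
[cite: FitznerVanDerHofstad2016NoBLE, §5.2 (5.10), (5.14) p. 1092; HeydenreichVanDerHofstad2017, Prop. 5.5] -/
theorem integrable_prodCosPow_sin_sq_sin_sq_cos_mul_Chat_pow_succ_succ {n : ℕ} (hd : 2 * n + 1 ≤ d)
    (a : Fin d → ℕ) (j j' : Fin d) (x : Fin d → ℤ) (β : ℝ) :
    Integrable (fun k => ((∏ μ, (Real.cos (k μ) ^ a μ * (if μ = j then Real.sin (k μ) ^ 2 else 1)
        * (if μ = j' then Real.sin (k μ) ^ 2 else 1)))
      * Real.cos (β * DhatSym d x k)) * Chat d 1 k ^ (n + 2)) (P d) := by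
  refine (integrable_weight_sin_sq_sin_sq_cos_mul_Chat_pow_succ_succ hd (measurable_prod_cosPow a)
    (abs_prod_cosPow_le_one a) j j' x β).congr (ae_of_all _ fun k => ?_)
  simp only [prod_cosPow_ite_sin_sq_ite_sin_sq_eq]

/-- **`u`-representation of `Tw_{n+1}[D̂^l D̂^{sin}]` at an axis node, sharp range `d ≥ 2n+1`** — the
conclusion of `srwTwist_succ_Dhat_pow_mul_Dsin_single_eq` VERBATIM, with its hypothesis `d ≥ 2n+3` replaced
by `d ≥ 2n+1` (the kept `sin²` absorbs one `Ĉ`): the average over `(j, p)` of Schwinger `u`-integrals of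
products over the coordinates of the rows with `cos^{a_μ(p)}` inserted and a `sin²` kept at `μ = j`
(row `T^{(a)} − T^{(a+2)}`, `integral_cos_pow_mul_sin_sq_row_eq_sub`).
[cite: FitznerVanDerHofstad2016NoBLE, §3.3.3 p. 1070, (3.34)–(3.38) p. 1071, §5.1.1 (5.2)–(5.5), §5.2 (5.9), (5.10) p. 1092; DLMF, 10.32.1] -/
theorem srwTwist_succ_Dhat_pow_mul_Dsin_single_eq_sharp (n : ℕ) (hd : 2 * n + 1 ≤ d) (i : Fin d)
    (m : ℤ) (β : ℝ) (l : ℕ) :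
    srwTwist d (n + 1) (fun k => Dhat d k ^ l * Dsin d k) (Pi.single i m) β
      = ((d : ℝ) ^ l)⁻¹ * (((d : ℝ) ^ 2)⁻¹ * ∑ j : Fin d, ∑ p : Fin l → Fin d,
          ((n ! : ℝ)⁻¹ * (∫ τ in Ioi (0:ℝ), τ ^ n * (Real.exp (-τ) *
          (∏ μ, ∫ t, (((Real.cos t) ^ (Finset.univ.filter (fun s => p s = μ)).card
              * (if μ = j then Real.sin t ^ 2 else 1) : ℝ) : ℂ)
            * Complex.exp (((τ / d * Real.cos t : ℝ) : ℂ)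
              + ((β / d * Real.cos (m * t) : ℝ) : ℂ) * Complex.I) ∂μI).re)) / (2 * π) ^ d)) := by
  -- the weight as ONE finite sum over pairs `(j, p)` of scaled product weights
  have hw : (fun k : Fin d → ℝ => Dhat d k ^ l * Dsin d k) = fun k => ∑ x : Fin d × (Fin l → Fin d),
      (((d : ℝ) ^ l)⁻¹ * ((d : ℝ) ^ 2)⁻¹) * ∏ μ, (Real.cos (k μ) ^ (Finset.univ.filter (fun t => x.2 t = μ)).card
        * (if μ = x.1 then Real.sin (k μ) ^ 2 else 1)) := by
    funext k
    rw [Dhat_pow_mul_Dsin_eq_sum, Fintype.sum_prod_type, ← mul_assoc, Finset.mul_sum]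
    simp_rw [Finset.mul_sum]
  have h1 : ∀ (x : Fin d × (Fin l → Fin d)) (μ : Fin d) (t : ℝ),
      |Real.cos t ^ (Finset.univ.filter (fun s => x.2 s = μ)).card
        * (if μ = x.1 then Real.sin t ^ 2 else 1)| ≤ 1 := by
    intro x μ t
    rw [abs_mul, abs_pow]
    refine mul_le_one₀ (pow_le_one₀ (abs_nonneg _) (abs_cos_le_one t)) (abs_nonneg _) ?_
    split_ifs
    · rw [abs_of_nonneg (sq_nonneg _)]; exact Real.sin_sq_le_one t
    · simp
  rw [hw, srwTwist_sum_weight_of_integrable (Finset.univ) (fun _ => ((d : ℝ) ^ l)⁻¹ * ((d : ℝ) ^ 2)⁻¹)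
    (fun (x : Fin d × (Fin l → Fin d)) (k : Fin d → ℝ) =>
      ∏ μ, (Real.cos (k μ) ^ (Finset.univ.filter (fun t => x.2 t = μ)).card
        * (if μ = x.1 then Real.sin (k μ) ^ 2 else 1))) (Pi.single i m) β
    (fun x _ => integrable_prodCosPow_sin_sq_cos_mul_Chat_pow_succ hd
      (fun μ => (Finset.univ.filter (fun t => x.2 t = μ)).card) x.1 (Pi.single i m) β),
    ← Finset.mul_sum, mul_assoc, Fintype.sum_prod_type]
  congr 2
  refine Finset.sum_congr rfl fun j _ => Finset.sum_congr rfl fun p _ => ?_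
  try dsimp only
  have h := srwTwist_succ_prod_single_eq_integral_of_integrable n i m β
    (fun μ t => Real.cos t ^ (Finset.univ.filter (fun s => p s = μ)).card
      * (if μ = j then Real.sin t ^ 2 else 1))
    (fun μ => by
      show Continuous fun t : ℝ => Real.cos t ^ (Finset.univ.filter (fun s => p s = μ)).card
        * (if μ = j then Real.sin t ^ 2 else 1)
      split_ifs <;> fun_prop) (h1 (j, p))
    (integrable_prodCosPow_sin_sq_cos_mul_Chat_pow_succ hd
      (fun μ => (Finset.univ.filter (fun t => p t = μ)).card) j (Pi.single i m) β)
  rw [h]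

/-- For even `l`, `|D̂|^l = D̂^l`: the `|D̂|^l D̂^{sin}` form of
`srwTwist_succ_Dhat_pow_mul_Dsin_single_eq_sharp` (sharp range `d ≥ 2n+1`).
[cite: FitznerVanDerHofstad2016NoBLE, (3.34)–(3.38) p. 1071, §5.1.1 (5.2)–(5.5), §5.2 (5.9), (5.10) p. 1092] -/
theorem srwTwist_succ_abs_Dhat_pow_mul_Dsin_single_eq_sharp_of_even (n : ℕ) (hd : 2 * n + 1 ≤ d)
    (i : Fin d) (m : ℤ) (β : ℝ) {l : ℕ} (hl : Even l) :
    srwTwist d (n + 1) (fun k => |Dhat d k| ^ l * Dsin d k) (Pi.single i m) β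
      = ((d : ℝ) ^ l)⁻¹ * (((d : ℝ) ^ 2)⁻¹ * ∑ j : Fin d, ∑ p : Fin l → Fin d,
          ((n ! : ℝ)⁻¹ * (∫ τ in Ioi (0:ℝ), τ ^ n * (Real.exp (-τ) *
          (∏ μ, ∫ t, (((Real.cos t) ^ (Finset.univ.filter (fun s => p s = μ)).card
              * (if μ = j then Real.sin t ^ 2 else 1) : ℝ) : ℂ)
            * Complex.exp (((τ / d * Real.cos t : ℝ) : ℂ)
              + ((β / d * Real.cos (m * t) : ℝ) : ℂ) * Complex.I) ∂μI).re)) / (2 * π) ^ d)) := by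
  have hw : (fun k : Fin d → ℝ => |Dhat d k| ^ l * Dsin d k) = fun k => Dhat d k ^ l * Dsin d k := by
    funext k; rw [hl.pow_abs]
  rw [hw]
  exact srwTwist_succ_Dhat_pow_mul_Dsin_single_eq_sharp n hd i m β l

/-- **`u`-representation of `Tw_{n+2}[D̂^l (D̂^{sin})²]` at an axis node, sharp range `d ≥ 2n+1`** — the
conclusion of `srwTwist_succ_Dhat_pow_mul_Dsin_sq_single_eq` at index `n+1` VERBATIM (order `τ^{n+1}`,
`((n+1)!)⁻¹`), with its hypothesis `d ≥ 2n+5` replaced by `d ≥ 2n+1` (the two kept `sin²` absorb two powers of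
`Ĉ`): the average over `(j, j', p)` of Schwinger `u`-integrals of products of rows with `cos^{a_μ(p)}` inserted
and `sin²` kept at `μ = j` and at `μ = j'` (rows `integral_cos_pow_mul_sin_sq_row_eq_sub`,
`integral_cos_pow_mul_sin_sq_mul_sin_sq_row_eq`).
[cite: FitznerVanDerHofstad2016NoBLE, §3.3.3 p. 1070, (3.34)–(3.38) p. 1071, §5.1.1 (5.2)–(5.5), §5.2 (5.9), (5.10), (5.14) p. 1092; DLMF, 10.32.1] -/
theorem srwTwist_succ_succ_Dhat_pow_mul_Dsin_sq_single_eq_sharp (n : ℕ) (hd : 2 * n + 1 ≤ d)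
    (i : Fin d) (m : ℤ) (β : ℝ) (l : ℕ) :
    srwTwist d (n + 1 + 1) (fun k => Dhat d k ^ l * Dsin d k ^ 2) (Pi.single i m) β
      = ((d : ℝ) ^ l)⁻¹ * (((d : ℝ) ^ 2)⁻¹ * (((d : ℝ) ^ 2)⁻¹
          * ∑ j : Fin d, ∑ j' : Fin d, ∑ p : Fin l → Fin d,
          (((n + 1) ! : ℝ)⁻¹ * (∫ τ in Ioi (0:ℝ), τ ^ (n + 1) * (Real.exp (-τ) *
          (∏ μ, ∫ t, (((Real.cos t) ^ (Finset.univ.filter (fun s => p s = μ)).card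
              * (if μ = j then Real.sin t ^ 2 else 1) * (if μ = j' then Real.sin t ^ 2 else 1) : ℝ) : ℂ)
            * Complex.exp (((τ / d * Real.cos t : ℝ) : ℂ)
              + ((β / d * Real.cos (m * t) : ℝ) : ℂ) * Complex.I) ∂μI).re)) / (2 * π) ^ d))) := by
  have hw : (fun k : Fin d → ℝ => Dhat d k ^ l * Dsin d k ^ 2)
      = fun k => ∑ x : Fin d × Fin d × (Fin l → Fin d),
      (((d : ℝ) ^ l)⁻¹ * (((d : ℝ) ^ 2)⁻¹ * ((d : ℝ) ^ 2)⁻¹))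
        * ∏ μ, (Real.cos (k μ) ^ (Finset.univ.filter (fun t => x.2.2 t = μ)).card
          * (if μ = x.1 then Real.sin (k μ) ^ 2 else 1) * (if μ = x.2.1 then Real.sin (k μ) ^ 2 else 1)) := by
    funext k
    rw [Dhat_pow_mul_Dsin_sq_eq_sum, Fintype.sum_prod_type]
    simp_rw [Fintype.sum_prod_type]
    rw [← mul_assoc, ← mul_assoc, Finset.mul_sum]
    simp_rw [Finset.mul_sum]
    congr 1; funext j; congr 1; funext j'; congr 1; funext p
    ring
  have h1 : ∀ (x : Fin d × Fin d × (Fin l → Fin d)) (μ : Fin d) (t : ℝ),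
      |Real.cos t ^ (Finset.univ.filter (fun s => x.2.2 s = μ)).card
        * (if μ = x.1 then Real.sin t ^ 2 else 1) * (if μ = x.2.1 then Real.sin t ^ 2 else 1)| ≤ 1 := by
    intro x μ t
    have hs1 : |(if μ = x.1 then Real.sin t ^ 2 else 1)| ≤ 1 := by
      split_ifs
      · rw [abs_of_nonneg (sq_nonneg _)]; exact Real.sin_sq_le_one t
      · simp
    have hs2 : |(if μ = x.2.1 then Real.sin t ^ 2 else 1)| ≤ 1 := by
      split_ifs
      · rw [abs_of_nonneg (sq_nonneg _)]; exact Real.sin_sq_le_one t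
      · simp
    rw [abs_mul, abs_mul, abs_pow]
    exact mul_le_one₀ (mul_le_one₀ (pow_le_one₀ (abs_nonneg _) (abs_cos_le_one t)) (abs_nonneg _) hs1)
      (abs_nonneg _) hs2
  rw [hw, srwTwist_sum_weight_of_integrable (Finset.univ)
    (fun _ => ((d : ℝ) ^ l)⁻¹ * (((d : ℝ) ^ 2)⁻¹ * ((d : ℝ) ^ 2)⁻¹))
    (fun (x : Fin d × Fin d × (Fin l → Fin d)) (k : Fin d → ℝ) =>
      ∏ μ, (Real.cos (k μ) ^ (Finset.univ.filter (fun t => x.2.2 t = μ)).card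
        * (if μ = x.1 then Real.sin (k μ) ^ 2 else 1) * (if μ = x.2.1 then Real.sin (k μ) ^ 2 else 1)))
    (Pi.single i m) β
    (fun x _ => integrable_prodCosPow_sin_sq_sin_sq_cos_mul_Chat_pow_succ_succ hd
      (fun μ => (Finset.univ.filter (fun t => x.2.2 t = μ)).card) x.1 x.2.1 (Pi.single i m) β),
    ← Finset.mul_sum, mul_assoc, mul_assoc, Fintype.sum_prod_type]
  simp_rw [Fintype.sum_prod_type]
  congr 3
  refine Finset.sum_congr rfl fun j _ => Finset.sum_congr rfl fun j' _ => Finset.sum_congr rfl fun p _ => ?_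
  try dsimp only
  have h := srwTwist_succ_prod_single_eq_integral_of_integrable (n + 1) i m β
    (fun μ t => Real.cos t ^ (Finset.univ.filter (fun s => p s = μ)).card
      * (if μ = j then Real.sin t ^ 2 else 1) * (if μ = j' then Real.sin t ^ 2 else 1))
    (fun μ => by
      show Continuous fun t : ℝ => Real.cos t ^ (Finset.univ.filter (fun s => p s = μ)).card
        * (if μ = j then Real.sin t ^ 2 else 1) * (if μ = j' then Real.sin t ^ 2 else 1)
      split_ifs <;> fun_prop) (h1 (j, j', p))
    (integrable_prodCosPow_sin_sq_sin_sq_cos_mul_Chat_pow_succ_succ hd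
      (fun μ => (Finset.univ.filter (fun t => p t = μ)).card) j j' (Pi.single i m) β)
  rw [h]

/-- For even `l`, `|D̂|^l = D̂^l`: the `|D̂|^l (D̂^{sin})²` form of
`srwTwist_succ_succ_Dhat_pow_mul_Dsin_sq_single_eq_sharp` (sharp range `d ≥ 2n+1`).
[cite: FitznerVanDerHofstad2016NoBLE, (3.34)–(3.38) p. 1071, §5.1.1 (5.2)–(5.5), §5.2 (5.9), (5.10), (5.14) p. 1092] -/
theorem srwTwist_succ_succ_abs_Dhat_pow_mul_Dsin_sq_single_eq_sharp_of_even (n : ℕ) (hd : 2 * n + 1 ≤ d)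
    (i : Fin d) (m : ℤ) (β : ℝ) {l : ℕ} (hl : Even l) :
    srwTwist d (n + 1 + 1) (fun k => |Dhat d k| ^ l * Dsin d k ^ 2) (Pi.single i m) β
      = ((d : ℝ) ^ l)⁻¹ * (((d : ℝ) ^ 2)⁻¹ * (((d : ℝ) ^ 2)⁻¹
          * ∑ j : Fin d, ∑ j' : Fin d, ∑ p : Fin l → Fin d,
          (((n + 1) ! : ℝ)⁻¹ * (∫ τ in Ioi (0:ℝ), τ ^ (n + 1) * (Real.exp (-τ) *
          (∏ μ, ∫ t, (((Real.cos t) ^ (Finset.univ.filter (fun s => p s = μ)).card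
              * (if μ = j then Real.sin t ^ 2 else 1) * (if μ = j' then Real.sin t ^ 2 else 1) : ℝ) : ℂ)
            * Complex.exp (((τ / d * Real.cos t : ℝ) : ℂ)
              + ((β / d * Real.cos (m * t) : ℝ) : ℂ) * Complex.I) ∂μI).re)) / (2 * π) ^ d))) := by
  have hw : (fun k : Fin d → ℝ => |Dhat d k| ^ l * Dsin d k ^ 2) = fun k => Dhat d k ^ l * Dsin d k ^ 2 := by
    funext k; rw [hl.pow_abs]
  rw [hw]
  exact srwTwist_succ_succ_Dhat_pow_mul_Dsin_sq_single_eq_sharp n hd i m β l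

/-! ### The `τ`-side counterpart: a kept `sin²` row is anchored at `π (I_0 − I_2)`, not `2π I_0` -/

/-- `∫_{[-π,π]} sin²t e^{v cos t} dt = π (I_0(v) − I_2(v))` (`sin² = (1 − cos 2t)/2`, DLMF 10.32.3).
[cite: DLMF, 10.32.3] -/
theorem integral_sin_sq_mul_exp_mul_cos_μI (v : ℝ) :
    ∫ t, Real.sin t ^ 2 * Real.exp (v * Real.cos t) ∂μI = π * (besselI 0 v - besselI 2 v) := by
  have h0 := integral_exp_mul_cos_μI v
  have h2 := integral_cos_mul_exp_mul_cos_muI v 2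
  have hi0 : Integrable (fun t : ℝ => Real.exp (v * Real.cos t)) μI := by
    have hc : Continuous (fun t : ℝ => Real.exp (v * Real.cos t)) := by fun_prop
    exact hc.continuousOn.integrableOn_compact isCompact_Icc
  have hi2 : Integrable (fun t : ℝ => Real.cos (((2 : ℤ) : ℝ) * t) * Real.exp (v * Real.cos t)) μI := by
    have hc : Continuous (fun t : ℝ => Real.cos (((2 : ℤ) : ℝ) * t) * Real.exp (v * Real.cos t)) := by
      fun_prop
    exact hc.continuousOn.integrableOn_compact isCompact_Icc
  have hptw : (fun t : ℝ => Real.sin t ^ 2 * Real.exp (v * Real.cos t))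
      = fun t => (1 / 2) * Real.exp (v * Real.cos t)
        - (1 / 2) * (Real.cos (((2 : ℤ) : ℝ) * t) * Real.exp (v * Real.cos t)) := by
    funext t
    have hc2 : Real.cos (((2 : ℤ) : ℝ) * t) = 2 * Real.cos t ^ 2 - 1 := by
      rw [show (((2 : ℤ) : ℝ)) = 2 by norm_num, Real.cos_two_mul]
    rw [hc2, Real.sin_sq]
    ring
  rw [hptw, integral_sub (hi0.const_mul _) (hi2.const_mul _), integral_const_mul, integral_const_mul,
    h0, h2]
  ring

/-- **Kept-`sin²` row majorant**: for a bounded real insertion `|g| ≤ 1`,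
`‖∫_{[-π,π]} g(t) sin²t · e^{v cos t + iy cos(mt)} dt‖ ≤ π (I_0(v) − I_2(v))` (`= ∫ sin²t e^{v cos t} dt
= 2π I_1(v)/v` for `v ≠ 0`) — a kept `sin²` replaces the unit anchor `2π I_0(v)` of `norm_weightRow_μI_le`
by a row smaller by a factor `≍ 1/v`; this is the `τ`-side form of `sin²(k_j) Ĉ(k) ≤ 2d`, and it is what makes
the `[T,∞)` tails of the sin²-kept product rows of this module summable one `Ĉ`-power beyond the bounded range.
[cite: DLMF, 10.32.3; FitznerVanDerHofstad2016NoBLE, §5.1.1 (5.2)–(5.4), §5.2 (5.10) p. 1092] -/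
theorem norm_weightRow_sin_sq_μI_le (g : ℝ → ℝ) (hg1 : ∀ t, |g t| ≤ 1) (v y : ℝ) (m : ℤ) :
    ‖∫ t, ((g t * Real.sin t ^ 2 : ℝ) : ℂ)
        * Complex.exp (((v * Real.cos t : ℝ) : ℂ) + ((y * Real.cos (m * t) : ℝ) : ℂ) * Complex.I) ∂μI‖
      ≤ π * (besselI 0 v - besselI 2 v) := by
  have hE : ∀ t : ℝ, ‖Complex.exp (((v * Real.cos t : ℝ) : ℂ)
      + ((y * Real.cos (m * t) : ℝ) : ℂ) * Complex.I)‖ = Real.exp (v * Real.cos t) := by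
    intro t
    rw [Complex.norm_exp, Complex.add_re, Complex.ofReal_re, Complex.mul_I_re, Complex.ofReal_im,
      neg_zero, add_zero]
  have hptw : ∀ t : ℝ, ‖((g t * Real.sin t ^ 2 : ℝ) : ℂ)
      * Complex.exp (((v * Real.cos t : ℝ) : ℂ) + ((y * Real.cos (m * t) : ℝ) : ℂ) * Complex.I)‖
      ≤ Real.sin t ^ 2 * Real.exp (v * Real.cos t) := by
    intro t
    rw [norm_mul, hE, Complex.norm_real, Real.norm_eq_abs, abs_mul,
      abs_of_nonneg (sq_nonneg (Real.sin t))]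
    exact mul_le_mul_of_nonneg_right (mul_le_of_le_one_left (sq_nonneg _) (hg1 t)) (Real.exp_pos _).le
  have hint : Integrable (fun t : ℝ => Real.sin t ^ 2 * Real.exp (v * Real.cos t)) μI := by
    have hc : Continuous (fun t : ℝ => Real.sin t ^ 2 * Real.exp (v * Real.cos t)) := by fun_prop
    exact hc.continuousOn.integrableOn_compact isCompact_Icc
  calc ‖∫ t, ((g t * Real.sin t ^ 2 : ℝ) : ℂ)
        * Complex.exp (((v * Real.cos t : ℝ) : ℂ) + ((y * Real.cos (m * t) : ℝ) : ℂ) * Complex.I) ∂μI‖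
      ≤ ∫ t, Real.sin t ^ 2 * Real.exp (v * Real.cos t) ∂μI :=
        norm_integral_le_of_norm_le hint (ae_of_all _ hptw)
    _ = π * (besselI 0 v - besselI 2 v) := integral_sin_sq_mul_exp_mul_cos_μI v

/-- The `cos^a sin²` row of the sin²-kept product representations is anchored at `π (I_0 − I_2)`:
`‖∫ cos^a t sin²t · e^{v cos t + iy cos(mt)} dt‖ ≤ π (I_0(v) − I_2(v))`.
[cite: DLMF, 10.32.3; FitznerVanDerHofstad2016NoBLE, §5.1.1 (5.2)–(5.4), §5.2 (5.10) p. 1092] -/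
theorem norm_cosPowSinSqRow_μI_le (a : ℕ) (v y : ℝ) (m : ℤ) :
    ‖∫ t, (((Real.cos t) ^ a * Real.sin t ^ 2 : ℝ) : ℂ)
        * Complex.exp (((v * Real.cos t : ℝ) : ℂ) + ((y * Real.cos (m * t) : ℝ) : ℂ) * Complex.I) ∂μI‖
      ≤ π * (besselI 0 v - besselI 2 v) :=
  norm_weightRow_sin_sq_μI_le (fun t => (Real.cos t) ^ a)
    (fun t => by rw [abs_pow]; exact pow_le_one₀ (abs_nonneg _) (abs_cos_le_one t)) v y m

end Literature.Probability.FitznerVanDerHofstad2017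

end
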